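import Summits.QuantumFields.YangMills.Theorems.BalabanUVNodesK2RunRowsSandwich

/-!
# Route `BalabanUVNodes`, rev-26ᴿ shape (director-ym №29 PRESS Variant R; plan g84 WORDS-2): THE BRIDGE «corner pair ∕ weak currency at θ ⟹ `RunRowsCont13 F θ`»
# — the registered K2⁷ v7c stub texts, and the display-free weak currency of `…K2RunRowsSandwich`, SUPPLY the rev-26ᴿ rows conjunct of K1⁸ ∕ hypothesis of K2⁸
# (plan g84 WORDS-2 (iii) «the ONE bridge still to type … WANTED, an4∕DEF-1 (O)-lane»; hypothesis form; 0 `def`, 0 `sorry`)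

Cell pub-balaban (b2b), seat `b2b-balaban-beta-an4` (BINDER row D4 OWNER), gen 153.  Helper keyed `--supports stmt-QuantumFields-26907 --as helper` (K1⁸ `StabilityBRunRowsAtRecordR13SepCoPH`, crux r3 DECIDING since rev 27 12afebc05bbc; plan g84 REV26R-LANDED, pub-ymgap I.31700: «INTENT-4 = the WANTED
bridge — GO, key --supports 26907»); bears on K1⁸'s rows conjunct ∕ K2⁸'s rows hypothesis by SHAPE — `RunRowsCont13`'s body is inlined here VERBATIM in the item-text spelling
`Node00.betaOfRecord₁₃ F 2 θ.toStage13Params`; count-neutral; NO skeleton is registered or re-keyed by this file; no route decl is referenced by name.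

THE ROWS CONJUNCT (rev 26ᴿ `RunRowsCont13 F θ`, Sketch26R :40): `∃ b r γ₀ M, 0 < γ₀ ∧ RunConstRemainder β_θ b r γ₀ ∧ (run-wise partial-sum floor −M) ∧ SurvCont β_θ γ₀`, `β_θ := Node00.betaOfRecord₁₃ F 2
θ.toStage13Params` (= `(Node00.datumOfRecord₁₃SepCoPH F 2 θ hP).βfun` by `rfl`, `Node00.βfun_datumOfRecord₁₃SepCoPH`).  THIS FILE:
* §1 `runRowsCont13Body_of_drift_runConstRemainder_survCont`: a drift `OneLoopDrift s A b`, a window `γ₀ > 0`, a radius `r ≤ s` with `RunConstRemainder β_θ b r γ₀`, and `SurvCont β_θ γ₀` ⟹ the rows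
  conjunct with `M := 2A` (the floor is DEF-1's `runwisePS_of_drift_runConstRemainder`, p596574) — i.e. the weak currency of `…K2RunRowsSandwich` §3∕§4 IS the rows conjunct up to the floor the drift pays;
* §1 `runRowsCont13Body_of_cornerPairAt`: 2ᶜᴰ's body ∧ 1ᶜᴿ's body at θ (the REGISTERED v7c texts 795c9e8285fed415, bodies inline) ⟹ the rows conjunct (rows by p603015's
  `runConstRemainder_of_runLeaves190H`, radius `c.ε₁·K_rem,L ≤ s` by the cap);
* §2 K-keyed: the registered pair {2ᶜᴰ, 1ᶜᴿ} ⟹ the ∀θ programme `RowsContAll` («prefix → (B) → window → rows conjunct», inline) (`rowsContAllK_of_cornerPairK`), and the weak K-text of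
  `…K2RunRowsSandwich` §3 ⟹ `RowsContAll` (`rowsContAllK_of_ownDrift_runConstRemainderK`); so every v6∕v7 supplier road of 20543 is a supplier road of the rev-26ᴿ rows, as WORDS-2 (iii) says.

HONEST FRAMING.  Implications between displayed HYPOTHESIS SHAPES; NOTHING of Bałaban's analysis is asserted or discharged; the drift, the anchor, the rows, (C) are hypotheses inhabited at no
tuple here (instance 0∕1); (D4) NOT discharged; K2⁷ 20543 `aside` since rev 27 (v7c skeleton kept as supplier road); K1⁸ 26907 OPEN (DECIDING), K2⁸ 26908 born-closed support; counts unmoved; [Balaban1987RG1] Thm 2 + (0.31)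
p. 259 is UNPROVED IN PRINT; route R4 closes the CONDITIONAL finite-𝕋⁴ rung `BalabanLadder.UV` only — NOT the continuum limit, NOT ℝ⁴, NOT OS, NOT the Yang–Mills mass gap, NOT Clay.  No `def`,
no `instance`, no `notation`, no `axiom`.  Sources (context only): [I] = [Balaban1987RG1] CMP **109** (1987): Thm 2 p. 259, Thm 3 p. 264, (1.20)–(1.22) p. 264, (2.12)–(2.14) p. 268, (5.10) p. 293;
[II] = [Balaban1988RG2Cluster] CMP **116** (1988): Lemma 3 (2.38) p. 20.
-/

noncomputable section

namespace Summit.QuantumFields.YangMills.Theorems.BalabanUVNodesK2RunRowsContOfCorner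

open Literature.MathematicalPhysics.QuantumFieldTheory.Balaban1983to89
open Literature.MathematicalPhysics.QuantumFieldTheory.Balaban1983to89.FlowStep
open Literature.MathematicalPhysics.QuantumFieldTheory.Balaban1983to89.B13ScaleTransfer (Pt)
open Literature.MathematicalPhysics.QuantumFieldTheory.Balaban1983to89.T4Continuum (T4Family)
open Literature.MathematicalPhysics.QuantumFieldTheory.Balaban1983to89.Beta.Drift (OneLoopDrift)
open Literature.MathematicalPhysics.QuantumFieldTheory.Balaban1983to89.Beta.RemainderChainLattice
open Literature.MathematicalPhysics.QuantumFieldTheory.Balaban1983to89.Beta.RemainderLimitTorus (LDom limKernel)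
open Literature.MathematicalPhysics.QuantumFieldTheory.Balaban1983to89.Beta.RemainderLocalityHolo
open Literature.MathematicalPhysics.QuantumFieldTheory.Balaban1983to89.Beta.RemainderDecay190
open Literature.MathematicalPhysics.QuantumFieldTheory.Balaban1983to89.Beta.RemainderDecay190HoloChain
open Summit.QuantumFields.YangMills.Theorems.BalabanUVNodesK2NamedJetsRemAt (ScaleAnchor)
open Summit.QuantumFields.YangMills.Theorems.BalabanUVNodesK2NamedJetsRunRemAt (RunConstRemainder SurvCont runwisePS_of_drift_runConstRemainder)
open Summit.QuantumFields.YangMills.Theorems.BalabanUVNodesK2RunRemAtOfChain190 (runConstRemainder_of_runLeaves190H)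

/-! ## §1 At one tuple: the rows conjunct from the weak currency ∕ from the corner pair's bodies -/

section AtTuple

variable (F : T4Family) (θ : Node00.Stage13HParams F 2) (hP : θ.Provisos₁₃SepCoPH F 2)

/-- **★ WEAK CURRENCY ⟹ THE ROWS CONJUNCT**: a drift `OneLoopDrift s A b`, a window `γ₀ > 0`, a radius `r ≤ s` with the run-wise constant remainder of the record's β relative to `b`, and
survivor continuity ⟹ rev 26ᴿ's `RunRowsCont13 F θ` body (INLINE, item-text spelling) with the floor `M := 2A` paid by the drift (`runwisePS_of_drift_runConstRemainder`).
CONDITIONAL; instance 0∕1. [cite: Balaban1987RG1, Thm 2 p.259 (first sentence), Thm 3 p.264, (2.12)-(2.14) p.268 and (5.10) p.293] -/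
theorem runRowsCont13Body_of_drift_runConstRemainder_survCont {b : ℕ → ℝ} {s A r γ₀ : ℝ} (hdrift : OneLoopDrift s A b) (hγ₀ : 0 < γ₀) (hr : r ≤ s)
    (hrem : RunConstRemainder (Node00.datumOfRecord₁₃SepCoPH F 2 θ hP).βfun b r γ₀) (hsc : SurvCont (Node00.datumOfRecord₁₃SepCoPH F 2 θ hP).βfun γ₀) :
    ∃ (b : ℕ → ℝ) (r γ₀ M : ℝ), 0 < γ₀ ∧ RunConstRemainder (Node00.betaOfRecord₁₃ F 2 θ.toStage13Params) b r γ₀ ∧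
      (∀ (n : ℕ) (gs : ℕ → ℝ), RGEqH n (Node00.betaOfRecord₁₃ F 2 θ.toStage13Params) gs → Step.InInterval γ₀ n gs →
        ∀ k, k ≤ n → -M ≤ ∑ j ∈ Finset.Ico k n, Node00.betaOfRecord₁₃ F 2 θ.toStage13Params j (prefixOf gs j)) ∧
      SurvCont (Node00.betaOfRecord₁₃ F 2 θ.toStage13Params) γ₀ :=
  ⟨b, r, γ₀, 2 * A, hγ₀, hrem, runwisePS_of_drift_runConstRemainder hdrift hrem hr, hsc⟩

/-- **★★ THE CORNER PAIR's BODIES AT θ ⟹ THE ROWS CONJUNCT** (plan g84 WORDS-2 (iii)'s WANTED bridge): 2ᶜᴰ's body (an anchored, positively drifting corner sequence) and 1ᶜᴿ's body at θ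
(the REGISTERED v7c texts, bodies inline) ⟹ `RunRowsCont13 F θ`'s body — rows by `runConstRemainder_of_runLeaves190H` at radius `c.ε₁·K_rem,L`, `≤ s` by the cap, floor `2A` by the drift, (C) as
delivered.  The anchor is read by 1ᶜᴿ's supplier only.  CONDITIONAL; instance 0∕1.
[cite: Balaban1987RG1, Thm 3 p.264, (1.20)-(1.22) p.264, (2.12)-(2.14) p.268 and (5.10) p.293; Balaban1988RG2Cluster, Lemma 3 (2.38) p.20] -/
theorem runRowsCont13Body_of_cornerPairAt
    (h₁ : ∃ (b : ℕ → ℝ) (s A : ℝ), ScaleAnchor (Node00.datumOfRecord₁₃SepCoPH F 2 θ hP).βfun b ∧ 0 < s ∧ OneLoopDrift s A b)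
    (h₂ : ∀ (b : ℕ → ℝ) (s A : ℝ), ScaleAnchor (Node00.datumOfRecord₁₃SepCoPH F 2 θ hP).βfun b → 0 < s → OneLoopDrift s A b →
      ∃ (M : ℕ) (_ : NeZero M) (μ ν : Fin 4) (c : B13.Consts) (ℓ α₂ : ℝ) (q : Consts190) (γ₀ : ℝ),
        (∀ (n : ℕ) (gs : ℕ → ℝ), RGEqH n (Node00.datumOfRecord₁₃SepCoPH F 2 θ hP).βfun gs → Step.InInterval γ₀ n gs → ∀ k, k ≤ n →
          ∃ a : LDom 4 → Pt 4 → ℝ, (Node00.datumOfRecord₁₃SepCoPH F 2 θ hP).βfun k (prefixOf gs k) - b k =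
            B12Beta.secondMoment (fun _ _ => limKernel a) μ ν ∧ Nonempty (PolLeavesTFac190H 4 M a c ℓ α₂ q)) ∧
        CondsL 4 c ℓ ∧ c.R22gen ℓ ∧ q.Valid c.δ₀ ∧ SignsL c α₂ q.B₃ ∧ 0 < γ₀ ∧
        c.ε₁ * remCoeffL 4 M c α₂ q.B₃ ≤ s ∧ SurvCont (Node00.datumOfRecord₁₃SepCoPH F 2 θ hP).βfun γ₀) :
    ∃ (b : ℕ → ℝ) (r γ₀ M : ℝ), 0 < γ₀ ∧ RunConstRemainder (Node00.betaOfRecord₁₃ F 2 θ.toStage13Params) b r γ₀ ∧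
      (∀ (n : ℕ) (gs : ℕ → ℝ), RGEqH n (Node00.betaOfRecord₁₃ F 2 θ.toStage13Params) gs → Step.InInterval γ₀ n gs →
        ∀ k, k ≤ n → -M ≤ ∑ j ∈ Finset.Ico k n, Node00.betaOfRecord₁₃ F 2 θ.toStage13Params j (prefixOf gs j)) ∧
      SurvCont (Node00.betaOfRecord₁₃ F 2 θ.toStage13Params) γ₀ := by
  obtain ⟨b, s, A, hanch, hs, hdrift⟩ := h₁
  obtain ⟨M, instM, μ, ν, c, ℓ, α₂, q, γ₀, hrun, hC, h22, hq, hsg, hγ₀, hcap, hcont⟩ := h₂ b s A hanch hs hdrift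
  exact runRowsCont13Body_of_drift_runConstRemainder_survCont F θ hP hdrift hγ₀ hcap
    (runConstRemainder_of_runLeaves190H hrun hC h22 hq hsg (by norm_num)) hcont

end AtTuple

/-! ## §2 K-keyed: the registered v7c pair, and the weak K-text, supply the ∀θ rows programme `RowsContAll` -/

section Keyed

/-- **★★ THE REGISTERED CORNER PAIR ⟹ THE ∀θ ROWS PROGRAMME** (`RowsContAll` of plan g84 WORDS-2, inline: prefix → (B) → window → the rows conjunct): 2ᶜᴰ `CornerDriftPos` and 1ᶜᴿ
`RunChain190AtCornerDriftSlope` (texts 795c9e8285fed415, inline with the crux's window text) give the rows at EVERY tuple carrying the crux's hypotheses — hence K2⁷ (via p606097) AND, with K1⁷,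
K1⁸'s conjunct at its witness (plan's `k1R8_of_k1_7_and_rowsContAll`).  CONDITIONAL; no stub proved here.
[cite: Balaban1987RG1, Thm 3 p.264, (2.12)-(2.14) p.268 and (5.10) p.293; Balaban1988RG2Cluster, Lemma 3 (2.38) p.20] -/
theorem rowsContAllK_of_cornerPairK
    (h₁ : ∀ (F : T4Family) (θ : Node00.Stage13HParams F 2) (hP : θ.Provisos₁₃SepCoPH F 2),
      (θ.ZhUnity F 2 ∧ θ.SlotsNondegenerate₁₃ F 2) → θ.Admissible F 2 →
      B16.EndStatementBPrinted (Node00.datumOfRecord₁₃SepCoPH F 2 θ hP).C →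
      (∃ γ₁ : ℝ, 0 < γ₁ ∧ ∀ γ : ℝ, 0 < γ → γ ≤ γ₁ →
        ∃ P : B12.RunParams, 1 ≤ P.K ∧ ((Node00.datumOfRecord₁₃SepCoPH F 2 θ hP).C P).flow.InInterval γ P.K) →
      ∃ (b : ℕ → ℝ) (s A : ℝ), ScaleAnchor (Node00.datumOfRecord₁₃SepCoPH F 2 θ hP).βfun b ∧ 0 < s ∧ OneLoopDrift s A b)
    (h₂ : ∀ (F : T4Family) (θ : Node00.Stage13HParams F 2) (hP : θ.Provisos₁₃SepCoPH F 2),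
      (θ.ZhUnity F 2 ∧ θ.SlotsNondegenerate₁₃ F 2) → θ.Admissible F 2 →
      B16.EndStatementBPrinted (Node00.datumOfRecord₁₃SepCoPH F 2 θ hP).C →
      (∃ γ₁ : ℝ, 0 < γ₁ ∧ ∀ γ : ℝ, 0 < γ → γ ≤ γ₁ →
        ∃ P : B12.RunParams, 1 ≤ P.K ∧ ((Node00.datumOfRecord₁₃SepCoPH F 2 θ hP).C P).flow.InInterval γ P.K) →
      ∀ (b : ℕ → ℝ) (s A : ℝ), ScaleAnchor (Node00.datumOfRecord₁₃SepCoPH F 2 θ hP).βfun b → 0 < s → OneLoopDrift s A b →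
      ∃ (M : ℕ) (_ : NeZero M) (μ ν : Fin 4) (c : B13.Consts) (ℓ α₂ : ℝ) (q : Consts190) (γ₀ : ℝ),
        (∀ (n : ℕ) (gs : ℕ → ℝ), RGEqH n (Node00.datumOfRecord₁₃SepCoPH F 2 θ hP).βfun gs → Step.InInterval γ₀ n gs → ∀ k, k ≤ n →
          ∃ a : LDom 4 → Pt 4 → ℝ, (Node00.datumOfRecord₁₃SepCoPH F 2 θ hP).βfun k (prefixOf gs k) - b k =
            B12Beta.secondMoment (fun _ _ => limKernel a) μ ν ∧ Nonempty (PolLeavesTFac190H 4 M a c ℓ α₂ q)) ∧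
        CondsL 4 c ℓ ∧ c.R22gen ℓ ∧ q.Valid c.δ₀ ∧ SignsL c α₂ q.B₃ ∧ 0 < γ₀ ∧
        c.ε₁ * remCoeffL 4 M c α₂ q.B₃ ≤ s ∧ SurvCont (Node00.datumOfRecord₁₃SepCoPH F 2 θ hP).βfun γ₀) :
    ∀ (F : T4Family) (θ : Node00.Stage13HParams F 2) (hP : θ.Provisos₁₃SepCoPH F 2),
      (θ.ZhUnity F 2 ∧ θ.SlotsNondegenerate₁₃ F 2) → θ.Admissible F 2 →
      B16.EndStatementBPrinted (Node00.datumOfRecord₁₃SepCoPH F 2 θ hP).C →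
      (∃ γ₁ : ℝ, 0 < γ₁ ∧ ∀ γ : ℝ, 0 < γ → γ ≤ γ₁ →
        ∃ P : B12.RunParams, 1 ≤ P.K ∧ ((Node00.datumOfRecord₁₃SepCoPH F 2 θ hP).C P).flow.InInterval γ P.K) →
      ∃ (b : ℕ → ℝ) (r γ₀ M : ℝ), 0 < γ₀ ∧ RunConstRemainder (Node00.betaOfRecord₁₃ F 2 θ.toStage13Params) b r γ₀ ∧
        (∀ (n : ℕ) (gs : ℕ → ℝ), RGEqH n (Node00.betaOfRecord₁₃ F 2 θ.toStage13Params) gs → Step.InInterval γ₀ n gs →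
          ∀ k, k ≤ n → -M ≤ ∑ j ∈ Finset.Ico k n, Node00.betaOfRecord₁₃ F 2 θ.toStage13Params j (prefixOf gs j)) ∧
        SurvCont (Node00.betaOfRecord₁₃ F 2 θ.toStage13Params) γ₀ :=
  fun F θ hP hU hθ hB hwin =>
    runRowsCont13Body_of_cornerPairAt F θ hP (h₁ F θ hP hU hθ hB hwin) (h₂ F θ hP hU hθ hB hwin)

/-- **THE WEAK K-TEXT ⟹ THE ∀θ ROWS PROGRAMME**: `…K2RunRowsSandwich` §3's display-free text («prefix → ∃ b s A γ₀ r, drift ∧ 0 < γ₀ ∧ r ≤ s ∧ RunConstRemainder ∧ SurvCont») gives the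
rows conjunct at every tuple (floor `2A`).  So the constant-road and modulus-road suppliers of 20543 are suppliers of the rev-26ᴿ rows.  CONDITIONAL.
[cite: Balaban1987RG1, Thm 3 p.264, (2.12)-(2.14) p.268 and (5.10) p.293] -/
theorem rowsContAllK_of_ownDrift_runConstRemainderK
    (h : ∀ (F : T4Family) (θ : Node00.Stage13HParams F 2) (hP : θ.Provisos₁₃SepCoPH F 2),
      (θ.ZhUnity F 2 ∧ θ.SlotsNondegenerate₁₃ F 2) → θ.Admissible F 2 →
      B16.EndStatementBPrinted (Node00.datumOfRecord₁₃SepCoPH F 2 θ hP).C →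
      (∃ γ₁ : ℝ, 0 < γ₁ ∧ ∀ γ : ℝ, 0 < γ → γ ≤ γ₁ →
        ∃ P : B12.RunParams, 1 ≤ P.K ∧ ((Node00.datumOfRecord₁₃SepCoPH F 2 θ hP).C P).flow.InInterval γ P.K) →
      ∃ (b : ℕ → ℝ) (s A γ₀ r : ℝ), OneLoopDrift s A b ∧ 0 < γ₀ ∧ r ≤ s ∧
        RunConstRemainder (Node00.datumOfRecord₁₃SepCoPH F 2 θ hP).βfun b r γ₀ ∧
        SurvCont (Node00.datumOfRecord₁₃SepCoPH F 2 θ hP).βfun γ₀) :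
    ∀ (F : T4Family) (θ : Node00.Stage13HParams F 2) (hP : θ.Provisos₁₃SepCoPH F 2),
      (θ.ZhUnity F 2 ∧ θ.SlotsNondegenerate₁₃ F 2) → θ.Admissible F 2 →
      B16.EndStatementBPrinted (Node00.datumOfRecord₁₃SepCoPH F 2 θ hP).C →
      (∃ γ₁ : ℝ, 0 < γ₁ ∧ ∀ γ : ℝ, 0 < γ → γ ≤ γ₁ →
        ∃ P : B12.RunParams, 1 ≤ P.K ∧ ((Node00.datumOfRecord₁₃SepCoPH F 2 θ hP).C P).flow.InInterval γ P.K) →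
      ∃ (b : ℕ → ℝ) (r γ₀ M : ℝ), 0 < γ₀ ∧ RunConstRemainder (Node00.betaOfRecord₁₃ F 2 θ.toStage13Params) b r γ₀ ∧
        (∀ (n : ℕ) (gs : ℕ → ℝ), RGEqH n (Node00.betaOfRecord₁₃ F 2 θ.toStage13Params) gs → Step.InInterval γ₀ n gs →
          ∀ k, k ≤ n → -M ≤ ∑ j ∈ Finset.Ico k n, Node00.betaOfRecord₁₃ F 2 θ.toStage13Params j (prefixOf gs j)) ∧
        SurvCont (Node00.betaOfRecord₁₃ F 2 θ.toStage13Params) γ₀ := by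
  intro F θ hP hU hθ hB hwin
  obtain ⟨b, s, A, γ₀, r, hdrift, hγ₀, hr, hrem, hsc⟩ := h F θ hP hU hθ hB hwin
  exact runRowsCont13Body_of_drift_runConstRemainder_survCont F θ hP hdrift hγ₀ hr hrem hsc

end Keyed

end Summit.QuantumFields.YangMills.Theorems.BalabanUVNodesK2RunRowsContOfCorner

end
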